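import Summits.AtomisticToContinuum.HydrodynamicLimit.Theorems.JParityClosureLocalSecondLawEquilibriumColdBallsFrozenTools

/-!
# Cold balls at frozen positions, part 2 (lead c3): the dominated and the spread regime

Stub `eq_coldBalls` (crux `JParityClosure.LocalSecondLaw`, stmt-AtomisticToContinuum-13081, line `exact-entropy-ledger-three-passivities`).
With `i₁` the heaviest and `j₁` the second heaviest particle of the ball (`β = b_{j₁} > 0`):
* DOMINATED support (`W < 2 b_{i₁}`): `ρ_r < 2B/(N+1)` and `θ_r ≥ β‖v_{i₁}−v_{j₁}‖²/(12B)` give, off the null set of coincident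
  velocities, `coldStat ≤ (2B/(N+1))(c₀ + 4 log⁺(6ΘB/β)² + 16 log⁺(1/‖Δv‖)²)`, whence `E_Q[coldStat] ≤ coldII(β)`
  (`lintegral_coldStat_dominated`, second log-moment `lintegral_posLogInv_sq_le`);
* SPREAD support (`2 b_{i₁} ≤ W`): `θ_r ≥ ‖Δv‖²/(6(N+1)²)`, AM–GM `F·𝟙_cold ≤ (sF² + s⁻¹𝟙_cold)/2` with `s = B/(ρ_r√(N+1))`, the
  fourth log-moment (`E F² ≤ S_I`), the Chebyshev bound of the cold event and `∑bᵢ² ≤ (N+1)B²` give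
  `E_Q[coldStat] ≤ B/(2√(N+1))·(S_I + K)` (registered sub-goal `lintegral_coldStat_spread`).

References: H. Spohn, *Large Scale Dynamics of Interacting Particles* (1991), Part I §2.3 (homogeneous Gibbs law: configurational
Gibbs measure ⊗ product Maxwellian); S. Goldstein, J. L. Lebowitz, Physica D 193 (2004) 53–66 (typicality of coarse-grained
observables at equilibrium).
-/

noncomputable section

namespace Summit.AtomisticToContinuum.HydrodynamicLimit.Theorems.LocalSecondLawEquilibrium.ColdFrozen

open scoped BigOperators Topology Classical MeasureTheory ENNReal InnerProductSpace
open Filter Set MeasureTheory ProbabilityTheory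
open Literature.MathematicalPhysics.KineticTheory
open Literature.Analysis.FluidPDE
open Summit.AtomisticToContinuum.HydrodynamicLimit.Theorems.LocalSecondLawNegative
open Summit.AtomisticToContinuum.HydrodynamicLimit.Theorems.LocalSecondLawLedger
open Summit.AtomisticToContinuum.HydrodynamicLimit.Theorems.LocalSecondLawLedger.L

variable {N : ℕ}

/-! ## Case C: dominated support -/

/-- **Dominated support**: if one particle carries more than half of the weight (`W < 2 b_max`) and `β > 0` is the second
largest weight, then `E_Q[coldStat] ≤ coldII(Θ, r, N, β)`. -/
theorem lintegral_coldStat_dominated {Θ r : ℝ} (hΘ : 0 < Θ) (hr : 0 < r) (ū : V3) (xs : Fin (N + 1) → T3)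
    (x₀ : T3) {i₁ j₁ : Fin (N + 1)} (hne : j₁ ≠ i₁) (hmax : ∀ k, cone r (xs k) x₀ ≤ cone r (xs i₁) x₀)
    (hβ : 0 < cone r (xs j₁) x₀) (hdom : ∑ k, cone r (xs k) x₀ < 2 * cone r (xs i₁) x₀) :
    ∫⁻ vs, ENNReal.ofReal (coldStat Θ r xs x₀ vs) ∂Measure.pi (fun _ : Fin (N + 1) => gaussMeasure ū Θ) ≤
      ENNReal.ofReal (coldII Θ r N (cone r (xs j₁) x₀)) := by
  have hB0 : 0 < 3 / (Real.pi * r ^ 3) := by positivity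
  have hbM0 : 0 < cone r (xs i₁) x₀ := hβ.trans_le (hmax j₁)
  have hbMB : cone r (xs i₁) x₀ ≤ 3 / (Real.pi * r ^ 3) := cone_le_const hr _ _
  have hW0 : 0 < ∑ k, cone r (xs k) x₀ :=
    lt_of_lt_of_le hβ (Finset.single_le_sum (fun k _ => cone_nonneg hr _ _) (Finset.mem_univ j₁))
  have hn : (0 : ℝ) < ((N + 1 : ℕ) : ℝ) := by positivity
  have hρle : ((N + 1 : ℕ) : ℝ)⁻¹ * ∑ k, cone r (xs k) x₀ ≤ 2 * (3 / (Real.pi * r ^ 3)) / ((N + 1 : ℕ) : ℝ) := by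
    rw [div_eq_mul_inv, mul_comm]
    exact mul_le_mul_of_nonneg_right (by linarith) (by positivity)
  have hA : 0 < 6 * Θ * (3 / (Real.pi * r ^ 3)) / cone r (xs j₁) x₀ := by positivity
  -- the pointwise bound off the null set of coincident velocities
  have hpt : ∀ vs : Fin (N + 1) → V3, vs i₁ ≠ vs j₁ → coldStat Θ r xs x₀ vs ≤
      2 * (3 / (Real.pi * r ^ 3)) / ((N + 1 : ℕ) : ℝ) *
        (coldC0 Θ + 4 * (max 0 (Real.log (6 * Θ * (3 / (Real.pi * r ^ 3)) / cone r (xs j₁) x₀))) ^ 2 +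
          16 * (max 0 (Real.log ‖vs i₁ - vs j₁‖⁻¹)) ^ 2) := by
    intro vs hv
    have hc0 := coldC0_pos Θ
    have hd : 0 < ‖vs i₁ - vs j₁‖ := norm_pos_iff.2 (sub_ne_zero.2 hv)
    have hθW := pair_le_theta_W_sq hr xs x₀ vs hne.symm hW0
    have hθ0 : 0 ≤ thetaC r (zipConfig (xs, vs)) x₀ := thetaC_nonneg' hr _ _
    have hprod : 0 < cone r (xs i₁) x₀ * cone r (xs j₁) x₀ * ‖vs i₁ - vs j₁‖ ^ 2 := by positivity
    have hθpos : 0 < thetaC r (zipConfig (xs, vs)) x₀ := by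
      by_contra h
      have h0 : thetaC r (zipConfig (xs, vs)) x₀ = 0 := le_antisymm (not_lt.1 h) hθ0
      rw [h0] at hθW
      nlinarith
    -- β d² ≤ 12 B θ
    have hlow : cone r (xs j₁) x₀ * ‖vs i₁ - vs j₁‖ ^ 2 ≤
        12 * (3 / (Real.pi * r ^ 3)) * thetaC r (zipConfig (xs, vs)) x₀ := by
      have h1 : (∑ k, cone r (xs k) x₀) ^ 2 ≤ (2 * cone r (xs i₁) x₀) ^ 2 :=
        pow_le_pow_left₀ hW0.le hdom.le 2
      have h2 : cone r (xs i₁) x₀ * (cone r (xs j₁) x₀ * ‖vs i₁ - vs j₁‖ ^ 2) ≤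
          cone r (xs i₁) x₀ * (12 * thetaC r (zipConfig (xs, vs)) x₀ * cone r (xs i₁) x₀) := by
        nlinarith [mul_le_mul_of_nonneg_left h1 (by positivity : (0 : ℝ) ≤ 3 * thetaC r (zipConfig (xs, vs)) x₀)]
      have h3 := le_of_mul_le_mul_left h2 hbM0
      nlinarith [mul_le_mul_of_nonneg_left hbMB (by positivity : (0 : ℝ) ≤ 12 * thetaC r (zipConfig (xs, vs)) x₀)]
    calc coldStat Θ r xs x₀ vs
        ≤ rhoC r (zipConfig (xs, vs)) x₀ * (1 + Real.log (thetaC r (zipConfig (xs, vs)) x₀) ^ 2) *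
            (if thetaC r (zipConfig (xs, vs)) x₀ < Θ / 2 then 1 else 0) := coldStat_le_indicator hΘ hr xs x₀ vs
      _ ≤ _ := by
          rw [rhoC_zipConfig]
          split_ifs with hcold
          · rw [mul_one]
            refine mul_le_mul hρle ?_ (by positivity) (by positivity)
            refine one_add_log_sq_le' hθpos hcold hA hd ?_
            rw [div_le_iff₀ hθpos]
            have hβd : 0 < cone r (xs j₁) x₀ * ‖vs i₁ - vs j₁‖ ^ 2 := by positivity
            have hθne : thetaC r (zipConfig (xs, vs)) x₀ ≠ 0 := hθpos.ne'
            have hβne : cone r (xs j₁) x₀ ≠ 0 := hβ.ne'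
            have hdne : ‖vs i₁ - vs j₁‖ ≠ 0 := hd.ne'
            calc Θ / 2 = 6 * Θ * (3 / (Real.pi * r ^ 3)) * thetaC r (zipConfig (xs, vs)) x₀ /
                  (12 * (3 / (Real.pi * r ^ 3)) * thetaC r (zipConfig (xs, vs)) x₀) := by
                  field_simp; ring
              _ ≤ 6 * Θ * (3 / (Real.pi * r ^ 3)) * thetaC r (zipConfig (xs, vs)) x₀ /
                  (cone r (xs j₁) x₀ * ‖vs i₁ - vs j₁‖ ^ 2) :=
                  div_le_div_of_nonneg_left (by positivity) hβd hlow
              _ = 6 * Θ * (3 / (Real.pi * r ^ 3)) / cone r (xs j₁) x₀ * (‖vs i₁ - vs j₁‖ ^ 2)⁻¹ *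
                  thetaC r (zipConfig (xs, vs)) x₀ := by
                  field_simp
          · simp only [mul_zero]; positivity
  -- integrate
  set c₁ : ℝ := 2 * (3 / (Real.pi * r ^ 3)) / ((N + 1 : ℕ) : ℝ) *
    (coldC0 Θ + 4 * (max 0 (Real.log (6 * Θ * (3 / (Real.pi * r ^ 3)) / cone r (xs j₁) x₀))) ^ 2) with hc₁
  set c₂ : ℝ := 2 * (3 / (Real.pi * r ^ 3)) / ((N + 1 : ℕ) : ℝ) * 16 with hc₂
  have hc₁0 : 0 ≤ c₁ := by have := coldC0_pos Θ; positivity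
  have hc₂0 : 0 ≤ c₂ := by positivity
  have hnull : ∀ᵐ vs ∂Measure.pi (fun _ : Fin (N + 1) => gaussMeasure ū Θ), vs i₁ ≠ vs j₁ := by
    rw [ae_iff]
    simpa using coldBalls_velEqNull (N := N) ū hΘ hne.symm
  have hae : ∀ᵐ vs ∂Measure.pi (fun _ : Fin (N + 1) => gaussMeasure ū Θ), ENNReal.ofReal (coldStat Θ r xs x₀ vs) ≤
      ENNReal.ofReal c₁ + ENNReal.ofReal c₂ * ENNReal.ofReal ((max 0 (Real.log ‖vs i₁ - vs j₁‖⁻¹)) ^ 2) := by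
    filter_upwards [hnull] with vs hv
    rw [← ENNReal.ofReal_mul hc₂0, ← ENNReal.ofReal_add hc₁0 (by positivity)]
    refine ENNReal.ofReal_le_ofReal ((hpt vs hv).trans (le_of_eq ?_))
    simp only [hc₁, hc₂]; ring
  have hD : 0 ≤ (2 * Real.pi * Θ) ^ (-(3 : ℝ) / 2) * (4 / 3 * Real.pi) := by positivity
  calc ∫⁻ vs, ENNReal.ofReal (coldStat Θ r xs x₀ vs) ∂Measure.pi (fun _ : Fin (N + 1) => gaussMeasure ū Θ)
      ≤ ∫⁻ vs, ENNReal.ofReal c₁ + ENNReal.ofReal c₂ * ENNReal.ofReal ((max 0 (Real.log ‖vs i₁ - vs j₁‖⁻¹)) ^ 2)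
          ∂Measure.pi (fun _ : Fin (N + 1) => gaussMeasure ū Θ) := lintegral_mono_ae hae
    _ = ENNReal.ofReal c₁ + ENNReal.ofReal c₂ *
          ∫⁻ vs, ENNReal.ofReal ((max 0 (Real.log ‖vs i₁ - vs j₁‖⁻¹)) ^ 2)
            ∂Measure.pi (fun _ : Fin (N + 1) => gaussMeasure ū Θ) := by
        rw [lintegral_add_left measurable_const, lintegral_const, measure_univ, mul_one,
          lintegral_const_mul' _ _ ENNReal.ofReal_ne_top]
    _ ≤ ENNReal.ofReal c₁ + ENNReal.ofReal c₂ *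
          ENNReal.ofReal (1 + 64 * ((2 * Real.pi * Θ) ^ (-(3 : ℝ) / 2) * (4 / 3 * Real.pi))) :=
        add_le_add le_rfl (mul_le_mul_right (lintegral_posLogInv_sq_le ū hΘ hne.symm) _)
    _ = ENNReal.ofReal (coldII Θ r N (cone r (xs j₁) x₀)) := by
        rw [← ENNReal.ofReal_mul hc₂0, ← ENNReal.ofReal_add hc₁0 (by positivity)]
        congr 1
        simp only [hc₁, hc₂, coldII, coldD]
        ring

/-! ## Case D: spread support -/

/-- **Spread support**: if no particle carries more than half of the weight (`2 b_max ≤ W`, at least two particles in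
the ball), then `E_Q[coldStat] ≤ B/(2√(N+1)) · (S_I(Θ, N) + K(Θ, ū))`. -/
theorem lintegral_coldStat_spread :
    ∀ {N : ℕ} {Θ r : ℝ}, 0 < Θ → 0 < r → ∀ (ū : V3) (xs : Fin (N + 1) → T3) (x₀ : T3) {i₁ j₁ : Fin (N + 1)}, j₁ ≠ i₁ → (∀ k, cone r (xs k) x₀ ≤ cone r (xs i₁) x₀) → (∀ k, k ≠ i₁ → cone r (xs k) x₀ ≤ cone r (xs j₁) x₀) → 0 < cone r (xs j₁) x₀ → 2 * cone r (xs i₁) x₀ ≤ ∑ k, cone r (xs k) x₀ → ∫⁻ vs, ENNReal.ofReal (coldStat Θ r xs x₀ vs) ∂Measure.pi (fun _ : Fin (N + 1) => gaussMeasure ū Θ) ≤ ENNReal.ofReal (3 / (Real.pi * r ^ 3) / (2 * Real.sqrt ((N + 1 : ℕ) : ℝ)) * (coldSI Θ N + chebConst Θ ū)) := by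
  intro N Θ r hΘ hr ū xs x₀ i₁ j₁ hne hmax hsec hβ hspread
  set Q : Measure (Fin (N + 1) → V3) := Measure.pi fun _ : Fin (N + 1) => gaussMeasure ū Θ with hQ
  set B : ℝ := 3 / (Real.pi * r ^ 3) with hB
  obtain ⟨W, hWdef⟩ : ∃ W : ℝ, W = ∑ k, cone r (xs k) x₀ := ⟨_, rfl⟩
  rw [← hWdef] at hspread
  have hB0 : 0 < B := by positivity
  have hbM0 : 0 < cone r (xs i₁) x₀ := hβ.trans_le (hmax j₁)
  have hW0' : 0 < ∑ k, cone r (xs k) x₀ :=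
    hβ.trans_le (Finset.single_le_sum (fun k _ => cone_nonneg hr _ _) (Finset.mem_univ j₁))
  have hW0 : 0 < W := by rw [hWdef]; exact hW0'
  have hn : (0 : ℝ) < ((N + 1 : ℕ) : ℝ) := by positivity
  have hsq0 : 0 < Real.sqrt ((N + 1 : ℕ) : ℝ) := Real.sqrt_pos.2 hn
  -- N ≥ 1 (two distinct labels)
  have hN1 : (1 : ℝ) ≤ (N : ℝ) := by
    have : 1 < Fintype.card (Fin (N + 1)) := Fintype.one_lt_card_iff_nontrivial.2 ⟨⟨j₁, i₁, hne⟩⟩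
    rw [Fintype.card_fin] at this
    exact_mod_cast Nat.lt_succ_iff.1 this
  -- the deterministic density and the weight bookkeeping
  obtain ⟨ρ₀, hρ₀⟩ : ∃ ρ₀ : ℝ, ρ₀ = ((N + 1 : ℕ) : ℝ)⁻¹ * W := ⟨_, rfl⟩
  have hρ₀0 : 0 < ρ₀ := by rw [hρ₀]; exact mul_pos (inv_pos.2 hn) hW0
  have hρ : ∀ vs, rhoC r (zipConfig (xs, vs)) x₀ = ρ₀ := fun vs => by rw [rhoC_zipConfig, hρ₀, hWdef]
  have hbM_ge : W ≤ ((N + 1 : ℕ) : ℝ) * cone r (xs i₁) x₀ := by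
    calc W = ∑ k, cone r (xs k) x₀ := hWdef
      _ ≤ ∑ _k : Fin (N + 1), cone r (xs i₁) x₀ := Finset.sum_le_sum fun k _ => hmax k
      _ = _ := by simp
  have hβ_ge : W - cone r (xs i₁) x₀ ≤ (N : ℝ) * cone r (xs j₁) x₀ := by
    have h1 : W - cone r (xs i₁) x₀ = ∑ k ∈ Finset.univ.erase i₁, cone r (xs k) x₀ := by
      rw [hWdef, ← Finset.sum_erase_add _ _ (Finset.mem_univ i₁)]; ring
    rw [h1]
    calc ∑ k ∈ Finset.univ.erase i₁, cone r (xs k) x₀ ≤ ∑ _k ∈ Finset.univ.erase i₁, cone r (xs j₁) x₀ :=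
          Finset.sum_le_sum fun k hk => hsec k (Finset.ne_of_mem_erase hk)
      _ = _ := by simp [Finset.card_erase_of_mem (Finset.mem_univ i₁)]
  have hsumsq : ∑ i, cone r (xs i) x₀ ^ 2 ≤ ((N + 1 : ℕ) : ℝ) * B ^ 2 := by
    calc ∑ i, cone r (xs i) x₀ ^ 2 ≤ ∑ _i : Fin (N + 1), B ^ 2 :=
          Finset.sum_le_sum fun i _ => pow_le_pow_left₀ (cone_nonneg hr _ _) (cone_le_const hr _ _) 2
      _ = _ := by simp
  -- the cold event and its Chebyshev bound
  have hcoldm : MeasurableSet {vs : Fin (N + 1) → V3 | thetaC r (zipConfig (xs, vs)) x₀ < Θ / 2} :=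
    measurableSet_lt ((measurable_thetaC_section r x₀).comp (measurable_zip_section xs)) measurable_const
  have hcheb := measure_coldEvent_le (r := r) hΘ ū xs x₀ hW0'
  have hP : (∑ i, (cone r (xs i) x₀ / ∑ k, cone r (xs k) x₀) ^ 2) = (∑ i, cone r (xs i) x₀ ^ 2) / W ^ 2 := by
    rw [← hWdef, Finset.sum_div]; exact Finset.sum_congr rfl fun i _ => by rw [div_pow]
  -- the AM–GM parameter
  obtain ⟨s, hs⟩ : ∃ s : ℝ, s = B / (ρ₀ * Real.sqrt ((N + 1 : ℕ) : ℝ)) := ⟨_, rfl⟩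
  have hs0 : 0 < s := by rw [hs]; exact div_pos hB0 (mul_pos hρ₀0 hsq0)
  -- the statistic F and its square integral
  set L : ℝ := max 0 (Real.log (3 * Θ * ((N + 1 : ℕ) : ℝ) ^ 2)) with hL
  have hL0 : 0 ≤ L := le_max_left _ _
  have hF2 : ∫⁻ vs, ENNReal.ofReal ((coldC0 Θ + 4 * L ^ 2 + 16 * (max 0 (Real.log ‖vs i₁ - vs j₁‖⁻¹)) ^ 2) ^ 2) ∂Q ≤
      ENNReal.ofReal (coldSI Θ N) := by
    have hc0 := coldC0_pos Θ
    have hpt : ∀ vs : Fin (N + 1) → V3,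
        ENNReal.ofReal ((coldC0 Θ + 4 * L ^ 2 + 16 * (max 0 (Real.log ‖vs i₁ - vs j₁‖⁻¹)) ^ 2) ^ 2) ≤
          ENNReal.ofReal (3 * coldC0 Θ ^ 2 + 48 * L ^ 4) +
            ENNReal.ofReal 768 * ENNReal.ofReal ((max 0 (Real.log ‖vs i₁ - vs j₁‖⁻¹)) ^ 4) := by
      intro vs
      have h0 : 0 ≤ max 0 (Real.log ‖vs i₁ - vs j₁‖⁻¹) := le_max_left _ _
      rw [← ENNReal.ofReal_mul (by norm_num), ← ENNReal.ofReal_add (by positivity) (by positivity)]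
      refine ENNReal.ofReal_le_ofReal ?_
      nlinarith [sq_nonneg (coldC0 Θ - 4 * L ^ 2), sq_nonneg (4 * L ^ 2 - 16 * (max 0 (Real.log ‖vs i₁ - vs j₁‖⁻¹)) ^ 2),
        sq_nonneg (coldC0 Θ - 16 * (max 0 (Real.log ‖vs i₁ - vs j₁‖⁻¹)) ^ 2)]
    calc _ ≤ ∫⁻ vs, ENNReal.ofReal (3 * coldC0 Θ ^ 2 + 48 * L ^ 4) +
            ENNReal.ofReal 768 * ENNReal.ofReal ((max 0 (Real.log ‖vs i₁ - vs j₁‖⁻¹)) ^ 4) ∂Q := lintegral_mono hpt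
      _ = ENNReal.ofReal (3 * coldC0 Θ ^ 2 + 48 * L ^ 4) +
            ENNReal.ofReal 768 * ∫⁻ vs, ENNReal.ofReal ((max 0 (Real.log ‖vs i₁ - vs j₁‖⁻¹)) ^ 4) ∂Q := by
          rw [lintegral_add_left measurable_const, lintegral_const, measure_univ, mul_one,
            lintegral_const_mul' _ _ ENNReal.ofReal_ne_top]
      _ ≤ ENNReal.ofReal (3 * coldC0 Θ ^ 2 + 48 * L ^ 4) +
            ENNReal.ofReal 768 * ENNReal.ofReal (64 * ((2 * Real.pi * Θ) ^ (-(3 : ℝ) / 2) * (4 / 3 * Real.pi))) :=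
          add_le_add le_rfl (mul_le_mul_right (coldBalls_logMomentFour ū hΘ hne.symm) _)
      _ = ENNReal.ofReal (coldSI Θ N) := by
          rw [← ENNReal.ofReal_mul (by norm_num), ← ENNReal.ofReal_add (by positivity) (by positivity)]
          congr 1
  -- the pointwise a.e. bound (AM–GM)
  have hnull : ∀ᵐ vs ∂Q, vs i₁ ≠ vs j₁ := by
    rw [ae_iff]
    simpa using coldBalls_velEqNull (N := N) ū hΘ hne.symm
  have hae : ∀ᵐ vs ∂Q, ENNReal.ofReal (coldStat Θ r xs x₀ vs) ≤
      ENNReal.ofReal (ρ₀ * s / 2) *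
          ENNReal.ofReal ((coldC0 Θ + 4 * L ^ 2 + 16 * (max 0 (Real.log ‖vs i₁ - vs j₁‖⁻¹)) ^ 2) ^ 2) +
        ENNReal.ofReal (ρ₀ / (2 * s)) *
          {vs : Fin (N + 1) → V3 | thetaC r (zipConfig (xs, vs)) x₀ < Θ / 2}.indicator 1 vs := by
    filter_upwards [hnull] with vs hv
    have hd : 0 < ‖vs i₁ - vs j₁‖ := norm_pos_iff.2 (sub_ne_zero.2 hv)
    set F : ℝ := coldC0 Θ + 4 * L ^ 2 + 16 * (max 0 (Real.log ‖vs i₁ - vs j₁‖⁻¹)) ^ 2 with hF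
    have hF0 : 0 ≤ F := by have := coldC0_pos Θ; positivity
    by_cases hcold : thetaC r (zipConfig (xs, vs)) x₀ < Θ / 2
    · -- on the cold event: the pair lower bound and the log bookkeeping, then AM–GM
      rw [Set.indicator_of_mem (by exact hcold), Pi.one_apply, mul_one]
      have hθW := pair_le_theta_W_sq hr xs x₀ vs hne.symm hW0'
      rw [← hWdef] at hθW
      have hθ0 : 0 ≤ thetaC r (zipConfig (xs, vs)) x₀ := thetaC_nonneg' hr _ _
      have hprod : 0 < cone r (xs i₁) x₀ * cone r (xs j₁) x₀ * ‖vs i₁ - vs j₁‖ ^ 2 := by positivity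
      have hθpos : 0 < thetaC r (zipConfig (xs, vs)) x₀ := by
        by_contra h
        have h0 : thetaC r (zipConfig (xs, vs)) x₀ = 0 := le_antisymm (not_lt.1 h) hθ0
        rw [h0] at hθW
        nlinarith
      -- d² ≤ 6 (N+1)² θ
      have hlow : ‖vs i₁ - vs j₁‖ ^ 2 ≤ 6 * ((N + 1 : ℕ) : ℝ) ^ 2 * thetaC r (zipConfig (xs, vs)) x₀ := by
        -- W² ≤ 2 N (N+1) bM β
        have h1 : W ^ 2 ≤ 2 * (N : ℝ) * ((N + 1 : ℕ) : ℝ) * (cone r (xs i₁) x₀ * cone r (xs j₁) x₀) := by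
          have hb : W ≤ 2 * ((N : ℝ) * cone r (xs j₁) x₀) := by linarith [hβ_ge]
          calc W ^ 2 = W * W := sq W
            _ ≤ (((N + 1 : ℕ) : ℝ) * cone r (xs i₁) x₀) * (2 * ((N : ℝ) * cone r (xs j₁) x₀)) :=
                mul_le_mul hbM_ge hb hW0.le (by positivity)
            _ = _ := by ring
        have h2 : W ^ 2 * ‖vs i₁ - vs j₁‖ ^ 2 ≤
            W ^ 2 * (2 * (N : ℝ) * ((N + 1 : ℕ) : ℝ) * (3 * thetaC r (zipConfig (xs, vs)) x₀)) := by
          calc W ^ 2 * ‖vs i₁ - vs j₁‖ ^ 2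
              ≤ 2 * (N : ℝ) * ((N + 1 : ℕ) : ℝ) * (cone r (xs i₁) x₀ * cone r (xs j₁) x₀) * ‖vs i₁ - vs j₁‖ ^ 2 :=
                mul_le_mul_of_nonneg_right h1 (sq_nonneg _)
            _ = 2 * (N : ℝ) * ((N + 1 : ℕ) : ℝ) * (cone r (xs i₁) x₀ * cone r (xs j₁) x₀ * ‖vs i₁ - vs j₁‖ ^ 2) := by
                ring
            _ ≤ 2 * (N : ℝ) * ((N + 1 : ℕ) : ℝ) * (3 * thetaC r (zipConfig (xs, vs)) x₀ * W ^ 2) :=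
                mul_le_mul_of_nonneg_left hθW (by positivity)
            _ = _ := by ring
        have h3 : ‖vs i₁ - vs j₁‖ ^ 2 ≤ 2 * (N : ℝ) * ((N + 1 : ℕ) : ℝ) * (3 * thetaC r (zipConfig (xs, vs)) x₀) :=
          le_of_mul_le_mul_left h2 (pow_pos hW0 2)
        have hNle : (N : ℝ) ≤ ((N + 1 : ℕ) : ℝ) := by push_cast; linarith
        calc ‖vs i₁ - vs j₁‖ ^ 2 ≤ 2 * (N : ℝ) * ((N + 1 : ℕ) : ℝ) * (3 * thetaC r (zipConfig (xs, vs)) x₀) := h3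
          _ = (N : ℝ) * (6 * ((N + 1 : ℕ) : ℝ) * thetaC r (zipConfig (xs, vs)) x₀) := by ring
          _ ≤ ((N + 1 : ℕ) : ℝ) * (6 * ((N + 1 : ℕ) : ℝ) * thetaC r (zipConfig (xs, vs)) x₀) :=
              mul_le_mul_of_nonneg_right hNle (by positivity)
          _ = _ := by ring
      have hlog : 1 + Real.log (thetaC r (zipConfig (xs, vs)) x₀) ^ 2 ≤ F := by
        rw [hF, hL]
        refine one_add_log_sq_le' hθpos hcold (by positivity) hd ?_
        rw [div_le_iff₀ hθpos]
        have hd2 : 0 < ‖vs i₁ - vs j₁‖ ^ 2 := by positivity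
        have hθne : thetaC r (zipConfig (xs, vs)) x₀ ≠ 0 := hθpos.ne'
        have hdne : ‖vs i₁ - vs j₁‖ ≠ 0 := hd.ne'
        calc Θ / 2 = 3 * Θ * ((N + 1 : ℕ) : ℝ) ^ 2 * thetaC r (zipConfig (xs, vs)) x₀ /
              (6 * ((N + 1 : ℕ) : ℝ) ^ 2 * thetaC r (zipConfig (xs, vs)) x₀) := by
              field_simp; ring
          _ ≤ 3 * Θ * ((N + 1 : ℕ) : ℝ) ^ 2 * thetaC r (zipConfig (xs, vs)) x₀ / ‖vs i₁ - vs j₁‖ ^ 2 :=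
              div_le_div_of_nonneg_left (by positivity) hd2 hlow
          _ = 3 * Θ * ((N + 1 : ℕ) : ℝ) ^ 2 * (‖vs i₁ - vs j₁‖ ^ 2)⁻¹ * thetaC r (zipConfig (xs, vs)) x₀ := by
              field_simp
      have hcs : coldStat Θ r xs x₀ vs ≤ ρ₀ * F := by
        calc coldStat Θ r xs x₀ vs ≤ _ := coldStat_le_indicator hΘ hr xs x₀ vs
          _ ≤ ρ₀ * F := by
              rw [if_pos hcold, mul_one, hρ vs]
              exact mul_le_mul_of_nonneg_left hlog hρ₀0.le
      have hamgm : F ≤ s / 2 * F ^ 2 + 1 / (2 * s) := by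
        have : 0 ≤ (s * F - 1) ^ 2 / (2 * s) := by positivity
        have h' : s / 2 * F ^ 2 + 1 / (2 * s) - F = (s * F - 1) ^ 2 / (2 * s) := by field_simp; ring
        linarith
      rw [← ENNReal.ofReal_mul (by positivity), ← ENNReal.ofReal_add (by positivity) (by positivity)]
      refine ENNReal.ofReal_le_ofReal (hcs.trans ?_)
      have := mul_le_mul_of_nonneg_left hamgm hρ₀0.le
      calc ρ₀ * F ≤ ρ₀ * (s / 2 * F ^ 2 + 1 / (2 * s)) := this
        _ = ρ₀ * s / 2 * F ^ 2 + ρ₀ / (2 * s) := by ring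
    · -- off the cold event the statistic vanishes
      have h0 : coldStat Θ r xs x₀ vs ≤ 0 := by
        calc coldStat Θ r xs x₀ vs ≤ _ := coldStat_le_indicator hΘ hr xs x₀ vs
          _ = 0 := by rw [if_neg hcold, mul_zero]
      rw [ENNReal.ofReal_of_nonpos h0]
      exact bot_le
  -- integrate
  have hmeasI : Measurable fun vs : Fin (N + 1) → V3 =>
      ENNReal.ofReal (ρ₀ / (2 * s)) * {vs : Fin (N + 1) → V3 | thetaC r (zipConfig (xs, vs)) x₀ < Θ / 2}.indicator 1 vs :=
    measurable_const.mul (measurable_one.indicator hcoldm)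
  calc ∫⁻ vs, ENNReal.ofReal (coldStat Θ r xs x₀ vs) ∂Q
      ≤ ∫⁻ vs, ENNReal.ofReal (ρ₀ * s / 2) *
            ENNReal.ofReal ((coldC0 Θ + 4 * L ^ 2 + 16 * (max 0 (Real.log ‖vs i₁ - vs j₁‖⁻¹)) ^ 2) ^ 2) +
          ENNReal.ofReal (ρ₀ / (2 * s)) *
            {vs : Fin (N + 1) → V3 | thetaC r (zipConfig (xs, vs)) x₀ < Θ / 2}.indicator 1 vs ∂Q :=
        lintegral_mono_ae hae
    _ = ENNReal.ofReal (ρ₀ * s / 2) *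
          ∫⁻ vs, ENNReal.ofReal ((coldC0 Θ + 4 * L ^ 2 + 16 * (max 0 (Real.log ‖vs i₁ - vs j₁‖⁻¹)) ^ 2) ^ 2) ∂Q +
        ENNReal.ofReal (ρ₀ / (2 * s)) * Q {vs : Fin (N + 1) → V3 | thetaC r (zipConfig (xs, vs)) x₀ < Θ / 2} := by
        rw [lintegral_add_right _ hmeasI, lintegral_const_mul' _ _ ENNReal.ofReal_ne_top,
          lintegral_const_mul' _ _ ENNReal.ofReal_ne_top, lintegral_indicator_one hcoldm]
    _ ≤ ENNReal.ofReal (ρ₀ * s / 2) * ENNReal.ofReal (coldSI Θ N) +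
        ENNReal.ofReal (ρ₀ / (2 * s)) * ENNReal.ofReal (chebConst Θ ū * ((∑ i, cone r (xs i) x₀ ^ 2) / W ^ 2)) := by
        refine add_le_add (mul_le_mul_right hF2 _) (mul_le_mul_right ?_ _)
        rw [← hP]; exact hcheb
    _ = ENNReal.ofReal (ρ₀ * s / 2 * coldSI Θ N + ρ₀ / (2 * s) * (chebConst Θ ū * ((∑ i, cone r (xs i) x₀ ^ 2) / W ^ 2))) := by
        have hSI := coldSI_nonneg hΘ.le N
        have hK := chebConst_nonneg hΘ.le ū
        have hx1 : 0 ≤ ρ₀ * s / 2 := by positivity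
        have hx3 : 0 ≤ ρ₀ / (2 * s) := by positivity
        have hx4 : 0 ≤ chebConst Θ ū * ((∑ i, cone r (xs i) x₀ ^ 2) / W ^ 2) :=
          mul_nonneg hK (div_nonneg (Finset.sum_nonneg fun i _ => sq_nonneg _) (sq_nonneg _))
        rw [← ENNReal.ofReal_mul hx1, ← ENNReal.ofReal_mul hx3,
          ← ENNReal.ofReal_add (mul_nonneg hx1 hSI) (mul_nonneg hx3 hx4)]
    _ ≤ ENNReal.ofReal (B / (2 * Real.sqrt ((N + 1 : ℕ) : ℝ)) * (coldSI Θ N + chebConst Θ ū)) := by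
        refine ENNReal.ofReal_le_ofReal ?_
        have hSI := coldSI_nonneg hΘ.le N
        have hK := chebConst_nonneg hΘ.le ū
        -- first term is exactly B S_I/(2√(N+1)); second is (∑b²)√(N+1) K /(2 B (N+1)²) ≤ B K/(2√(N+1))
        have h1 : ρ₀ * s / 2 * coldSI Θ N = B / (2 * Real.sqrt ((N + 1 : ℕ) : ℝ)) * coldSI Θ N := by
          rw [hs]; field_simp
        have h2 : ρ₀ / (2 * s) * (chebConst Θ ū * ((∑ i, cone r (xs i) x₀ ^ 2) / W ^ 2)) ≤
            B / (2 * Real.sqrt ((N + 1 : ℕ) : ℝ)) * chebConst Θ ū := by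
          have hsq2 : Real.sqrt ((N + 1 : ℕ) : ℝ) ^ 2 = ((N + 1 : ℕ) : ℝ) := Real.sq_sqrt hn.le
          have heq : ρ₀ / (2 * s) * (chebConst Θ ū * ((∑ i, cone r (xs i) x₀ ^ 2) / W ^ 2)) =
              (∑ i, cone r (xs i) x₀ ^ 2) * Real.sqrt ((N + 1 : ℕ) : ℝ) / (2 * B * ((N + 1 : ℕ) : ℝ) ^ 2) * chebConst Θ ū := by
            rw [hs, hρ₀]; field_simp
          rw [heq]
          refine mul_le_mul_of_nonneg_right ?_ hK
          rw [div_le_div_iff₀ (by positivity) (by positivity)]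
          -- (∑b²) √n (2√n) ≤ B (2 B n²): ∑b² · 2 n ≤ 2 B² n²
          calc (∑ i, cone r (xs i) x₀ ^ 2) * Real.sqrt ((N + 1 : ℕ) : ℝ) * (2 * Real.sqrt ((N + 1 : ℕ) : ℝ))
              = 2 * ((∑ i, cone r (xs i) x₀ ^ 2) * (Real.sqrt ((N + 1 : ℕ) : ℝ) * Real.sqrt ((N + 1 : ℕ) : ℝ))) := by ring
            _ = 2 * ((∑ i, cone r (xs i) x₀ ^ 2) * ((N + 1 : ℕ) : ℝ)) := by rw [Real.mul_self_sqrt hn.le]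
            _ ≤ 2 * ((((N + 1 : ℕ) : ℝ) * B ^ 2) * ((N + 1 : ℕ) : ℝ)) := by
                refine mul_le_mul_of_nonneg_left (mul_le_mul_of_nonneg_right hsumsq hn.le) (by norm_num)
            _ = B * (2 * B * ((N + 1 : ℕ) : ℝ) ^ 2) := by ring
        calc _ = B / (2 * Real.sqrt ((N + 1 : ℕ) : ℝ)) * coldSI Θ N +
              ρ₀ / (2 * s) * (chebConst Θ ū * ((∑ i, cone r (xs i) x₀ ^ 2) / W ^ 2)) := by rw [h1]
          _ ≤ B / (2 * Real.sqrt ((N + 1 : ℕ) : ℝ)) * coldSI Θ N + B / (2 * Real.sqrt ((N + 1 : ℕ) : ℝ)) * chebConst Θ ū :=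
              add_le_add le_rfl h2
          _ = _ := by ring


end Summit.AtomisticToContinuum.HydrodynamicLimit.Theorems.LocalSecondLawEquilibrium.ColdFrozen

end
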